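import Summits.Ventures.PercRepro.C025ProfileRankFourCert

/-!
# The rank-4 certificate, the nonnegative form: `w4n`, the assembly without a positivity hypothesis, and (Cap)(b) (night-3 g7)

`w4` of C025ProfileRankFourCert is negative in one degenerate shape that never occurs on simple rank-4 matroids
(`ρ(E ∖ S) = 0`, i.e. `S = E`, with `|B| ≥ 3` and `j = 2`: the denominator `r + 1 − j` is `−1`), so the positivity
hypothesis `hw` of `profileIneq_two_three_rank_le_four_of_cert` cannot be discharged for ALL matroids. This module repairs
that: `w4n M B S := max 0 (w4 M B S)` is nonnegative by construction, agrees with `w4` wherever `w4 ≥ 0` (in particular on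
simple rank-4 matroids, where `ρ(E∖S) ≥ 1` for every rank-3 set), and the assembly `profileIneq_two_three_rank_le_four_of_certN`
needs only (Cap) and (Dem) for `w4n` on simple rank-4 matroids. Also the first pieces of (Cap): `w4n_eq_zero_of_three_le_sdiff_card`,
`w4n_le_half_of_sdiff_card_two`, and (Cap)(b) `cap_w4n_card_four_of_no_triple` (a four-point rank-3 set without a
collinear triple: six pairs, each paid at most `1/2`).
-/

open scoped Matroid

namespace PercRepro

open Set Finset ThmH

section RankFourCertN

variable {α : Type} [DecidableEq α] {M : Matroid α} [M.Finite]

/-- The nonnegative form of the rank-4 certificate. -/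
noncomputable def w4n (M : Matroid α) [M.Finite] (B S : Finset α) : ℚ := max 0 (w4 M B S)

/-- `w4n ≥ 0`. -/
theorem w4n_nonneg (B S : Finset α) : 0 ≤ w4n M B S := le_max_left _ _

/-- `w4n` dominates `w4`. -/
theorem w4_le_w4n (B S : Finset α) : w4 M B S ≤ w4n M B S := le_max_right _ _

/-- **The rank-`≤ 4` assembly with the nonnegative rule**: (Cap) and (Dem) for `w4n` on every simple matroid of rank `4`
give `(Π_{2,3})` on every matroid of rank `≤ 4`. -/
theorem profileIneq_two_three_rank_le_four_of_certN
    (hCert : ∀ (N : Matroid α) [N.Finite], N.eRank = (4 : ℕ∞) → (∀ T ⊆ N.E, T.encard ≤ 2 → N.Indep T) →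
      (∀ S ∈ Shadow.levelSet N 3, ∑ B ∈ (Profile.Rq N 2).filter (fun B => B ⊆ S), w4n N B S ≤ 3) ∧
      (∀ B ∈ Profile.Rq N 2, 3 ≤ crk N B →
        (crk N B : ℚ) ≤ ∑ S ∈ (Shadow.levelSet N 3).filter (fun S => B ⊆ S), w4n N B S))
    (M : Matroid α) [M.Finite] (hM : M.eRank ≤ (4 : ℕ∞)) : Profile.ProfileIneq M 2 3 := by
  apply profileIneq_two_three_of_simple_rank_le 4 _ M hM
  intro N _ hR hsimple
  have hRtop : N.eRank ≠ ⊤ := N.eRank_ne_top_iff.2 inferInstance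
  obtain ⟨R, hRe⟩ := ENat.ne_top_iff_exists.1 hRtop
  have hR4 : R ≤ 4 := by rw [← hRe] at hR; exact_mod_cast hR
  rcases lt_or_eq_of_le hR4 with hlt | heq
  · rcases lt_or_eq_of_le (Nat.lt_succ_iff.1 hlt) with hlt3 | heq3
    · apply profileIneq_of_eRank_lt
      rw [← hRe]; exact_mod_cast hlt3
    · exact Profile.profileIneq_top (R := 3) (by rw [← hRe, heq3]) 2
  · subst heq
    obtain ⟨hCap, hDem⟩ := hCert N hRe.symm hsimple
    -- the double count with the nonnegative rule: a verbatim re-run of `profileIneq_two_three_of_cert` for `w4n`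
    unfold Profile.ProfileIneq
    have hswap : ∑ B ∈ Profile.Rq N 2, ∑ S ∈ (Shadow.levelSet N 3).filter (fun S => B ⊆ S), w4n N B S =
        ∑ S ∈ Shadow.levelSet N 3, ∑ B ∈ (Profile.Rq N 2).filter (fun B => B ⊆ S), w4n N B S := by
      apply Finset.sum_comm'
      intro B S
      simp only [Finset.mem_filter]
      tauto
    have h1 : ∑ B ∈ Profile.Rq N 2, Profile.price N 2 3 B ≤
        ∑ B ∈ Profile.Rq N 2, (1 / 3 : ℚ) * ∑ S ∈ (Shadow.levelSet N 3).filter (fun S => B ⊆ S), w4n N B S := by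
      apply Finset.sum_le_sum
      intro B hB
      rw [price_two_three_eq]
      split_ifs with h
      · have := hDem B hB h
        linarith
      · exact mul_nonneg (by norm_num) (Finset.sum_nonneg (fun S _ => w4n_nonneg B S))
    have h2 : ∑ S ∈ Shadow.levelSet N 3, ∑ B ∈ (Profile.Rq N 2).filter (fun B => B ⊆ S), w4n N B S ≤
        ∑ _S ∈ Shadow.levelSet N 3, (3 : ℚ) := Finset.sum_le_sum hCap
    rw [Finset.sum_const, nsmul_eq_mul] at h2
    rw [← Finset.mul_sum, hswap] at h1
    linarith

/-- Nothing is paid to a set with three or more points outside it. -/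
theorem w4n_eq_zero_of_three_le_sdiff_card {B S : Finset α} (h : 3 ≤ (S \ B).card) : w4n M B S = 0 := by
  unfold w4n w4
  simp only
  have h1 : (S \ B).card ≠ 1 := by omega
  have h2 : ¬ ((S \ B).card = 2 ∧ B.card = 2) := by omega
  split_ifs <;> simp

/-- A set with exactly two points outside it is paid at most `1/2`. -/
theorem w4n_le_half_of_sdiff_card_two {B S : Finset α} (h : (S \ B).card = 2) : w4n M B S ≤ 1 / 2 := by
  unfold w4n w4
  simp only
  have h1 : (S \ B).card ≠ 1 := by omega
  rw [if_neg h1]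
  by_cases hp : crk M B < 3
  · rw [if_pos hp]; norm_num
  · rw [if_neg hp]
    by_cases hb : (S \ B).card = 2 ∧ B.card = 2
    · rw [if_pos hb]
      have hp3 : (3 : ℚ) ≤ (crk M B : ℚ) := by exact_mod_cast (not_lt.1 hp)
      by_cases hc1 : jB M B = 1 ∧ crk M S + 2 = crk M B
      · rw [if_pos hc1]
        have hpos : (0 : ℚ) < (crk M B : ℚ) - 1 := by linarith
        have hle : (1 : ℚ) / ((crk M B : ℚ) - 1) ≤ 1 / 2 := by
          rw [div_le_div_iff₀ hpos (by norm_num)]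
          linarith
        exact max_le (by norm_num) hle
      · rw [if_neg hc1]
        by_cases hc2 : jB M B = 2 ∧ crk M B = 4
        · rw [if_pos hc2]
          split_ifs <;> norm_num
        · rw [if_neg hc2]; norm_num
    · rw [if_neg hb]; norm_num

/-- In a simple matroid, the rank-`2` subsets of a four-point set with no collinear triple are among its six pairs. -/
theorem card_filter_Rq_two_le_six_of_no_triple {S : Finset α} (hS4 : S.card = 4)
    (htri : ∀ T ⊆ S, T.card = 3 → M.eRk (T : Set α) = 3) :
    ((Profile.Rq M 2).filter (fun B => B ⊆ S)).card ≤ 6 := by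
  have hsub : (Profile.Rq M 2).filter (fun B => B ⊆ S) ⊆ S.powersetCard 2 := by
    intro B hB
    rw [Finset.mem_filter, Profile.mem_Rq] at hB
    rw [Finset.mem_powersetCard]
    refine ⟨hB.2, ?_⟩
    rcases lt_trichotomy B.card 2 with hlt | heq | hgt
    · exfalso
      have h1 : M.eRk (B : Set α) ≤ (B : Set α).encard := M.eRk_le_encard _
      rw [hB.1.2, Set.encard_coe_eq_coe_finsetCard] at h1
      have : 2 ≤ B.card := by exact_mod_cast h1
      omega
    · exact heq
    · exfalso
      obtain ⟨T, hTB, hTc⟩ := Finset.exists_subset_card_eq (show 3 ≤ B.card by omega)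
      have h3 := htri T (hTB.trans hB.2) hTc
      have h1 : M.eRk (T : Set α) ≤ M.eRk (B : Set α) := M.eRk_mono (Finset.coe_subset.2 hTB)
      rw [h3, hB.1.2] at h1
      exact absurd h1 (by decide)
  calc ((Profile.Rq M 2).filter (fun B => B ⊆ S)).card ≤ (S.powersetCard 2).card := Finset.card_le_card hsub
    _ = Nat.choose 4 2 := by rw [Finset.card_powersetCard, hS4]
    _ = 6 := by decide

/-- Every rank-`2` subset of a four-point set with no collinear triple is a pair. -/
theorem card_eq_two_of_mem_filter_no_triple {S : Finset α} (htri : ∀ T ⊆ S, T.card = 3 → M.eRk (T : Set α) = 3)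
    {B : Finset α} (hB : B ∈ (Profile.Rq M 2).filter (fun B => B ⊆ S)) : B.card = 2 := by
  rw [Finset.mem_filter, Profile.mem_Rq] at hB
  rcases lt_trichotomy B.card 2 with hlt | heq | hgt
  · exfalso
    have h1 : M.eRk (B : Set α) ≤ (B : Set α).encard := M.eRk_le_encard _
    rw [hB.1.2, Set.encard_coe_eq_coe_finsetCard] at h1
    have : 2 ≤ B.card := by exact_mod_cast h1
    omega
  · exact heq
  · exfalso
    obtain ⟨T, hTB, hTc⟩ := Finset.exists_subset_card_eq (show 3 ≤ B.card by omega)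
    have h3 := htri T (hTB.trans hB.2) hTc
    have h1 : M.eRk (T : Set α) ≤ M.eRk (B : Set α) := M.eRk_mono (Finset.coe_subset.2 hTB)
    rw [h3, hB.1.2] at h1
    exact absurd h1 (by decide)

/-- **(Cap)(b)**: a four-point rank-3 set without a collinear triple pays at most `3`. -/
theorem cap_w4n_card_four_of_no_triple {S : Finset α} (hS4 : S.card = 4)
    (htri : ∀ T ⊆ S, T.card = 3 → M.eRk (T : Set α) = 3) :
    ∑ B ∈ (Profile.Rq M 2).filter (fun B => B ⊆ S), w4n M B S ≤ 3 := by
  have hle : ∀ B ∈ (Profile.Rq M 2).filter (fun B => B ⊆ S), w4n M B S ≤ 1 / 2 := by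
    intro B hB
    have hBc := card_eq_two_of_mem_filter_no_triple htri hB
    have hBS : B ⊆ S := (Finset.mem_filter.1 hB).2
    apply w4n_le_half_of_sdiff_card_two
    rw [Finset.card_sdiff_of_subset hBS, hS4, hBc]
  calc ∑ B ∈ (Profile.Rq M 2).filter (fun B => B ⊆ S), w4n M B S
      ≤ ∑ _B ∈ (Profile.Rq M 2).filter (fun B => B ⊆ S), (1 / 2 : ℚ) := Finset.sum_le_sum hle
    _ = (((Profile.Rq M 2).filter (fun B => B ⊆ S)).card : ℚ) * (1 / 2) := by
        rw [Finset.sum_const, nsmul_eq_mul]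
    _ ≤ 6 * (1 / 2) := by
        have := card_filter_Rq_two_le_six_of_no_triple hS4 htri
        have h' : (((Profile.Rq M 2).filter (fun B => B ⊆ S)).card : ℚ) ≤ 6 := by exact_mod_cast this
        linarith
    _ = 3 := by norm_num

end RankFourCertN

end PercRepro
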